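import Literature.AnabelianGeometry.SemiGraphs.SectionFibreBranchStep
import Literature.AnabelianGeometry.SemiGraphs.TieLocalStars
import Literature.AnabelianGeometry.SemiGraphs.TieLabels
import Literature.AnabelianGeometry.SemiGraphs.PreimageComponentsIncidence
import Literature.AnabelianGeometry.SemiGraphs.ProperBranchLifting
import HarnessLib

/-!
# Section fibres along a restricted covering: the two incidence steps of the sheet walk
# ([SemiAnbd] §2, proof of Cor. 2.7 (i) p. 30)

Mochizuki, *Semi-graphs of anabelioids*, Publ. RIMS **42** (2006), §2, proof of Cor. 2.7 (i) p. 30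
("`ℋ′` injects into `𝒢′` as a subgraph") [cite: MochizukiSemiAnbd2006, Cor. 2.7(i) p.30]; Def. 2.2 (i)
p. 23 (vertices / edges of the covering are the components of the `A_v` / `A_e`).  PROOF-ONLY (abc-iut
cell, layer L3, gap row G-L3-R1-E3 «(Surj) under branch alignment», abc-iut-L3-d3; part D of the sheet
argument for section fibres).  Setting as in `SectionFibreBranchStep.lean`, plus LABELS: components
`oV w ⊆ A_{φ w}`, `oE e′ ⊆ A_{φ e′}` in bijection with the vertices/edges of `𝒢′`, satisfying the branch
clause of `IsFiniteEtaleCoveringOf`, through which the section `s` factors (the TIE of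
abc-iut-f-161, `Hom.tie_localLabels`), and a preimage component `K` of the connected sub-graph `ℍ`.
The sheet walk runs on the incidence semi-graph of a connected `Y ∈ B(𝒢_ℍ)` over `A|_ℍ`; its vertex
predicate at `(u, c)` is «some `w ∈ K` over `u` has `c` over the label `oV w` and the section fibre
`Ψ_c` factoring through `W_w`», its edge predicate at `(e, d)` is «some `e′ ∈ K` over `e` has `W_{e′}`
meeting `Ψ_d`».  This file proves the two incidence steps:
* `BObj.component_eq_of_mem_branchImage_ranges`, `BObj.componentOver_eq_of_mem_ranges` — branch
  images of distinct components are disjoint (fibre form);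
* `Hom.sectionE_factors_reindexed` — the edge constituent of the section factors through the
  re-indexed edge label;
* `Hom.walkStep_vertex_to_edge` — vertex predicate at `(u, c)` ⇒ edge predicate at an incident
  `(e, d)` (the edge of `K` is FOUND through the labels: `oE`-preimage of the component under `f(d)`,
  its branch over `b` abuts to the witness vertex by the branch clause and label-injectivity);
* `Hom.walkStep_edge_to_vertex` — edge predicate at `(e, d)` ⇒ vertex predicate at an incident
  `(u, c)` (branch lifting along the proper base, part C's edge ⇒ vertex step, and the label of `c`
  read off through the branch clause).
No definition; nothing here takes a side on [IUTchIII] Cor. 3.12.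
-/

namespace Literature.AnabelianGeometry.SemiGraphs

open CategoryTheory CategoryTheory.Limits CategoryTheory.PreGaloisCategory
open Literature.AnabelianGeometry.Anabelioids

universe v₁ u₁ u

namespace SemiGraphOfAnabelioids

variable {𝒢 𝒢' : SemiGraphOfAnabelioids.{v₁, u₁, u}}

/-! ### Branch images of distinct components are disjoint -/

namespace BObj

variable (A : 𝒢.BObj)

/-- **Branch images of distinct components are disjoint** (fibre form): if a point of the fibre of
`T_e` lies in `ψ_b(b^* P)` and in `ψ_b(b^* P′)` for components `P`, `P′` of `S_v`, then `P = P′`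
(`b^*` preserves the fibre functor; components with a common fibre point coincide).
[cite: MochizukiSemiAnbd2006, Def. 2.2(i) p.23] -/
theorem component_eq_of_mem_branchImage_ranges (b : 𝒢.graph.Branch) (v : 𝒢.graph.Vertex)
    (h : 𝒢.graph.abuts b = some v) (P P' : π₀Obj (A.S v))
    (FE : 𝒢.E (𝒢.graph.edgeOf b) ⥤ FintypeCat.{v₁}) [FiberFunctor FE] (x : FE.obj (A.T (𝒢.graph.edgeOf b)))
    (hx : x ∈ Set.range (FE.map ((𝒢.pull b v h).pullback.map P.1.arrow ≫ (A.ψ b v h).hom)))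
    (hx' : x ∈ Set.range (FE.map ((𝒢.pull b v h).pullback.map P'.1.arrow ≫ (A.ψ b v h).hom))) :
    P = P' := by
  let bY := (𝒢.pull b v h).pullback
  haveI : PreservesFiniteLimits bY := (𝒢.pull b v h).property.1
  haveI : PreservesFiniteColimits bY := (𝒢.pull b v h).property.2
  let F : 𝒢.V v ⥤ FintypeCat.{v₁} := bY ⋙ FE
  haveI : FiberFunctor F := fiberFunctor_comp_of_exact _ _
  obtain ⟨a, ha⟩ := hx
  obtain ⟨a', ha'⟩ := hx'
  rw [FE.map_comp, FintypeCat.comp_apply] at ha ha'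
  have heq : F.map P.1.arrow a = F.map P'.1.arrow a' :=
    map_iso_injective FE (A.ψ b v h) (ha.trans ha'.symm)
  exact component_eq_of_mem_range F P P' ⟨a, rfl⟩ ⟨a', heq.symm⟩

/-- **The component under, from a common point**: if a point of the fibre of `T_e` lies in the
component `Q` and in `ψ_b(b^* P)`, then `P` is the component of `S_v` under `Q` along `b`.
[cite: MochizukiSemiAnbd2006, Def. 2.2(i) p.23] -/
theorem componentOver_eq_of_mem_ranges (b : 𝒢.graph.Branch) (v : 𝒢.graph.Vertex)
    (h : 𝒢.graph.abuts b = some v) (Q : π₀Obj (A.T (𝒢.graph.edgeOf b))) (P : π₀Obj (A.S v))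
    (FE : 𝒢.E (𝒢.graph.edgeOf b) ⥤ FintypeCat.{v₁}) [FiberFunctor FE] (x : FE.obj (A.T (𝒢.graph.edgeOf b)))
    (hxQ : x ∈ Set.range (FE.map Q.1.arrow))
    (hxP : x ∈ Set.range (FE.map ((𝒢.pull b v h).pullback.map P.1.arrow ≫ (A.ψ b v h).hom))) :
    A.componentOver b v h Q = P := by
  have hle := A.le_branchImage_componentOver b v h Q
  haveI := A.mono_map_arrow_comp_ψ b v h (A.componentOver b v h Q).1
  let n := Subobject.ofLEMk Q.1 _ hle
  have hn : n ≫ ((𝒢.pull b v h).pullback.map (A.componentOver b v h Q).1.arrow ≫ (A.ψ b v h).hom) =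
      Q.1.arrow := Subobject.ofLEMk_comp hle
  refine A.component_eq_of_mem_branchImage_ranges b v h _ P FE x ?_ hxP
  obtain ⟨q, rfl⟩ := hxQ
  exact ⟨FE.map n q, by rw [← FintypeCat.comp_apply, ← FE.map_comp, hn]⟩

end BObj

/-! ### The edge constituent of the section factors through the re-indexed edge label -/

/-- If the edge constituent `s_{e′}` of the section factors through `φ_{e′}^*(oE e′ ↪ A_{φ e′})`, then,
re-indexed along `p : φ e′ = e₁`, it factors through `φ_{e′}^*((p ▸ oE e′) ↪ A_{e₁})`.
[cite: MochizukiSemiAnbd2006, Rem. 2.11.1 p.32] -/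
theorem Hom.sectionE_factors_reindexed (φ : Hom 𝒢' 𝒢) (A : 𝒢.BObj) {T : 𝒢'.BObj}
    (s : T ⟶ φ.pullbackFunctor.obj A) (oE : ∀ e' : 𝒢'.graph.Edge, π₀Obj (A.T (φ.base.edgeMap e')))
    (e' : 𝒢'.graph.Edge)
    (hsE : ∃ k : T.T e' ⟶ (φ.φE e' (φ.base.edgeMap e') rfl).pullback.obj (oE e').1,
      k ≫ (φ.φE e' (φ.base.edgeMap e') rfl).pullback.map (oE e').1.arrow = s.fT e')
    (e₁ : 𝒢.graph.Edge) (p : φ.base.edgeMap e' = e₁) :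
    ∃ k : T.T e' ⟶ (φ.φE e' e₁ p).pullback.obj ((p ▸ oE e' : π₀Obj (A.T e₁)).1 : 𝒢.E e₁),
      k ≫ (φ.φE e' e₁ p).pullback.map (p ▸ oE e' : π₀Obj (A.T e₁)).1.arrow =
        s.fT e' ≫ (φ.reindexIso e' (φ.base.edgeMap e') e₁ rfl p).hom.app A := by
  subst p
  obtain ⟨k, hk⟩ := hsE
  refine ⟨k, ?_⟩
  have h : φ.reindexIso e' (φ.base.edgeMap e') (φ.base.edgeMap e') rfl rfl = Iso.refl _ := rfl
  rw [hk, h]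
  simp only [Iso.refl_hom, NatTrans.id_app]
  exact (Category.comp_id _).symm

/-! ### Edge ⇒ vertex: the label of the vertex component -/

/-- **The vertex component inherits the label** (edge ⇒ vertex, label half).  At a branch `β` of `𝒢′`
abutting to `ω`, over `b := φ β` at `u := φ ω` (both in `ℍ`), let `c ⊆ Y_u` and `d ⊆ Y_e` be
components with `d` under `c` along `b`.  If the edge section fibre `Ψ_d` (edge section `s_{f′}`
re-indexed to `e = edgeOf b`) has a point, then `f|_c : c → A_u` factors through the vertex label
`oV ω ↪ A_u`: the section point lies in the edge label (re-indexed), which is therefore the component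
holding `f(d)`; the component of `A_u` under it along `b` is `oV ω` (branch clause), and `f(c)` meets
`ψ_b(b^* oV ω)` through `d`. [cite: MochizukiSemiAnbd2006, Def. 2.2(i) p.23] -/
theorem Hom.label_of_sectionFibre_edge_point (φ : Hom 𝒢' 𝒢) (A : 𝒢.BObj) (H : 𝒢.graph.Subgraph)
    (T : 𝒢'.BObj) (hTE : ∀ e', IsTerminal (T.T e')) (s : T ⟶ φ.pullbackFunctor.obj A)
    (oV : ∀ v' : 𝒢'.graph.Vertex, π₀Obj (A.S (φ.base.vertexMap v')))
    (oE : ∀ e' : 𝒢'.graph.Edge, π₀Obj (A.T (φ.base.edgeMap e')))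
    (hobr : ∀ (b' : 𝒢'.graph.Branch) (v' : 𝒢'.graph.Vertex) (h' : 𝒢'.graph.abuts b' = some v'),
      ∃ f : ((oE (𝒢'.graph.edgeOf b')).1 : 𝒢.E (φ.base.edgeMap (𝒢'.graph.edgeOf b'))) ⟶
          (𝒢.transportE (φ.base.edgeOf_branchMap b')).obj
            ((𝒢.pull (φ.base.branchMap b') (φ.base.vertexMap v')
              (φ.base.abuts_branchMap b' v' h')).pullback.obj ((oV v').1 : 𝒢.V (φ.base.vertexMap v'))),
        f ≫ (𝒢.transportE (φ.base.edgeOf_branchMap b')).map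
              ((𝒢.pull _ _ (φ.base.abuts_branchMap b' v' h')).pullback.map (oV v').1.arrow ≫
                (A.ψ (φ.base.branchMap b') (φ.base.vertexMap v') (φ.base.abuts_branchMap b' v' h')).hom) ≫
            eqToHom (𝒢.transportE_obj_T A (φ.base.edgeOf_branchMap b')) =
          (oE (𝒢'.graph.edgeOf b')).1.arrow)
    (hsE : ∀ e', ∃ k : T.T e' ⟶ (φ.φE e' (φ.base.edgeMap e') rfl).pullback.obj (oE e').1,
      k ≫ (φ.φE e' (φ.base.edgeMap e') rfl).pullback.map (oE e').1.arrow = s.fT e')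
    (β : 𝒢'.graph.Branch) (ω : 𝒢'.graph.Vertex) (hβω : 𝒢'.graph.abuts β = some ω)
    (huH : φ.base.vertexMap ω ∈ H.verts) (heH : 𝒢.graph.edgeOf (φ.base.branchMap β) ∈ H.edges)
    (Y : (𝒢.restrict H).BObj) (f : Y ⟶ (𝒢.restrictFunctor H).obj A)
    (c : π₀Obj (Y.S ⟨φ.base.vertexMap ω, huH⟩))
    (d : π₀Obj (Y.T ⟨𝒢.graph.edgeOf (φ.base.branchMap β), heH⟩))
    (hdc : d.1 ≤ Y.branchImage ⟨φ.base.branchMap β, heH⟩ ⟨φ.base.vertexMap ω, huH⟩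
      ((SemiGraph.Subgraph.abuts_eq_some_iff H _ _).mpr (φ.base.abuts_branchMap β ω hβω)) c.1)
    (Fe : 𝒢'.E (𝒢'.graph.edgeOf β) ⥤ FintypeCat.{v₁}) [FiberFunctor Fe]
    (π : Fe.obj (pullback
      ((φ.φE (𝒢'.graph.edgeOf β) (𝒢.graph.edgeOf (φ.base.branchMap β))
          (φ.base.edgeOf_branchMap β).symm).pullback.map
        (d.1.arrow ≫ f.fT ⟨𝒢.graph.edgeOf (φ.base.branchMap β), heH⟩))
      (s.fT (𝒢'.graph.edgeOf β) ≫
        (φ.reindexIso (𝒢'.graph.edgeOf β) (φ.base.edgeMap (𝒢'.graph.edgeOf β))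
          (𝒢.graph.edgeOf (φ.base.branchMap β)) rfl (φ.base.edgeOf_branchMap β).symm).hom.app A))) :
    ∃ m : (Subobject.underlying.obj c.1 : 𝒢.V (φ.base.vertexMap ω)) ⟶ Subobject.underlying.obj (oV ω).1,
      m ≫ (oV ω).1.arrow = c.1.arrow ≫ f.fS ⟨φ.base.vertexMap ω, huH⟩ := by
  have hbu : H.toSemiGraph.abuts ⟨φ.base.branchMap β, heH⟩ =
      some (⟨φ.base.vertexMap ω, huH⟩ : H.toSemiGraph.Vertex) :=
    (SemiGraph.Subgraph.abuts_eq_some_iff H _ _).mpr (φ.base.abuts_branchMap β ω hβω)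
  -- canonical names
  let Φe : 𝒢.E (𝒢.graph.edgeOf (φ.base.branchMap β)) ⥤ 𝒢'.E (𝒢'.graph.edgeOf β) :=
    (φ.φE (𝒢'.graph.edgeOf β) (𝒢.graph.edgeOf (φ.base.branchMap β))
      (φ.base.edgeOf_branchMap β).symm).pullback
  haveI : PreservesFiniteLimits Φe := (φ.φE _ _ _).property.1
  haveI : PreservesFiniteColimits Φe := (φ.φE _ _ _).property.2
  let bY : 𝒢.V (φ.base.vertexMap ω) ⥤ 𝒢.E (𝒢.graph.edgeOf (φ.base.branchMap β)) :=
    (𝒢.pull (φ.base.branchMap β) (φ.base.vertexMap ω) (φ.base.abuts_branchMap β ω hβω)).pullback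
  haveI : PreservesFiniteLimits bY := (𝒢.pull _ _ _).property.1
  haveI : PreservesFiniteColimits bY := (𝒢.pull _ _ _).property.2
  let FE : 𝒢.E (𝒢.graph.edgeOf (φ.base.branchMap β)) ⥤ FintypeCat.{v₁} := Φe ⋙ Fe
  haveI : FiberFunctor FE := fiberFunctor_comp_of_exact _ _
  let FV : 𝒢.V (φ.base.vertexMap ω) ⥤ FintypeCat.{v₁} := bY ⋙ FE
  haveI : FiberFunctor FV := fiberFunctor_comp_of_exact _ _
  let Aψ := A.ψ (φ.base.branchMap β) (φ.base.vertexMap ω) (φ.base.abuts_branchMap β ω hβω)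
  let Aψh : bY.obj (A.S (φ.base.vertexMap ω)) ⟶ A.T (𝒢.graph.edgeOf (φ.base.branchMap β)) := Aψ.hom
  let Yψh : bY.obj (Y.S ⟨φ.base.vertexMap ω, huH⟩) ⟶
      Y.T ⟨𝒢.graph.edgeOf (φ.base.branchMap β), heH⟩ :=
    (Y.ψ ⟨φ.base.branchMap β, heH⟩ ⟨φ.base.vertexMap ω, huH⟩ hbu).hom
  let fu : Y.S ⟨φ.base.vertexMap ω, huH⟩ ⟶ A.S (φ.base.vertexMap ω) := f.fS ⟨φ.base.vertexMap ω, huH⟩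
  let fe : Y.T ⟨𝒢.graph.edgeOf (φ.base.branchMap β), heH⟩ ⟶
      A.T (𝒢.graph.edgeOf (φ.base.branchMap β)) := f.fT ⟨𝒢.graph.edgeOf (φ.base.branchMap β), heH⟩
  let cY : 𝒢.V (φ.base.vertexMap ω) := Subobject.underlying.obj c.1
  let dY : 𝒢.E (𝒢.graph.edgeOf (φ.base.branchMap β)) := Subobject.underlying.obj d.1
  haveI : PreGaloisCategory.IsConnected cY := c.2
  haveI : PreGaloisCategory.IsConnected dY := d.2
  let ιc : cY ⟶ Y.S ⟨φ.base.vertexMap ω, huH⟩ := c.1.arrow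
  let ιd : dY ⟶ Y.T ⟨𝒢.graph.edgeOf (φ.base.branchMap β), heH⟩ := d.1.arrow
  let sE : T.T (𝒢'.graph.edgeOf β) ⟶ Φe.obj (A.T (𝒢.graph.edgeOf (φ.base.branchMap β))) :=
    s.fT (𝒢'.graph.edgeOf β) ≫
      (φ.reindexIso (𝒢'.graph.edgeOf β) (φ.base.edgeMap (𝒢'.graph.edgeOf β))
        (𝒢.graph.edgeOf (φ.base.branchMap β)) rfl (φ.base.edgeOf_branchMap β).symm).hom.app A
  let g₁ : Φe.obj dY ⟶ Φe.obj (A.T (𝒢.graph.edgeOf (φ.base.branchMap β))) := Φe.map (ιd ≫ fe)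
  -- the re-indexed edge label and its relation to `oV ω` (branch clause)
  let Qt : π₀Obj (A.T (𝒢.graph.edgeOf (φ.base.branchMap β))) :=
    (φ.base.edgeOf_branchMap β).symm ▸ oE (𝒢'.graph.edgeOf β)
  let Qa : Subobject.underlying.obj Qt.1 ⟶ A.T (𝒢.graph.edgeOf (φ.base.branchMap β)) := Qt.1.arrow
  have hcomp : A.componentOver (φ.base.branchMap β) (φ.base.vertexMap ω)
      (φ.base.abuts_branchMap β ω hβω) Qt = oV ω :=
    φ.componentOver_localLabel_eq A oV oE hobr β ω hβω (φ.base.branchMap β) rfl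
  have hle : Qt.1 ≤ A.branchImage (φ.base.branchMap β) (φ.base.vertexMap ω)
      (φ.base.abuts_branchMap β ω hβω) (oV ω).1 :=
    (A.componentOver_eq_iff_le_branchImage _ _ _ Qt (oV ω)).mp hcomp
  haveI := A.mono_map_arrow_comp_ψ (φ.base.branchMap β) (φ.base.vertexMap ω)
    (φ.base.abuts_branchMap β ω hβω) (oV ω).1
  let n : Subobject.underlying.obj Qt.1 ⟶ bY.obj (Subobject.underlying.obj (oV ω).1) :=
    Subobject.ofLEMk Qt.1 _ hle
  have hn : n ≫ bY.map (oV ω).1.arrow ≫ Aψh = Qa := Subobject.ofLEMk_comp hle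
  -- `d` under `c`
  haveI hmono : Mono (((𝒢.restrict H).pull ⟨φ.base.branchMap β, heH⟩ ⟨φ.base.vertexMap ω, huH⟩
      hbu).pullback.map c.1.arrow ≫ (Y.ψ ⟨φ.base.branchMap β, heH⟩ ⟨φ.base.vertexMap ω, huH⟩ hbu).hom) :=
    Y.mono_map_arrow_comp_ψ _ _ hbu c.1
  let k : dY ⟶ bY.obj cY := @Subobject.ofLEMk _ _ _ _ d.1 _ hmono hdc
  have hk : k ≫ bY.map ιc ≫ Yψh = ιd := @Subobject.ofLEMk_comp _ _ _ _ d.1 _ hmono hdc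
  have hf : bY.map fu ≫ Aψh = Yψh ≫ fe := f.comm ⟨φ.base.branchMap β, heH⟩ ⟨φ.base.vertexMap ω, huH⟩ hbu
  have E1 : k ≫ bY.map (ιc ≫ fu) ≫ Aψh = ιd ≫ fe := by
    calc k ≫ bY.map (ιc ≫ fu) ≫ Aψh = k ≫ bY.map ιc ≫ (bY.map fu ≫ Aψh) := by
          rw [bY.map_comp, Category.assoc]
      _ = k ≫ bY.map ιc ≫ Yψh ≫ fe := by rw [hf]
      _ = (k ≫ bY.map ιc ≫ Yψh) ≫ fe := by simp only [Category.assoc]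
      _ = ιd ≫ fe := by rw [hk]
  -- the point of `d` under `π`, over the section point
  haveI : Subsingleton (Fe.obj (T.T (𝒢'.graph.edgeOf β))) :=
    subsingleton_fiber_of_isTerminal Fe (hTE _)
  obtain ⟨tE⟩ := nonempty_fiber_of_isTerminal Fe (hTE (𝒢'.graph.edgeOf β))
  let y : FE.obj dY := Fe.map (pullback.fst g₁ sE) π
  have hy : FE.map (ιd ≫ fe) y = Fe.map sE tE := by
    change Fe.map g₁ (Fe.map (pullback.fst g₁ sE) π) = _
    rw [← FintypeCat.comp_apply, ← Fe.map_comp, pullback.condition, Fe.map_comp,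
      FintypeCat.comp_apply]
    congr 1
    exact Subsingleton.elim _ _
  -- the section point lies in the re-indexed edge label, hence `f(d) ⊆ Qt`
  obtain ⟨kE, hkE⟩ := φ.sectionE_factors_reindexed A s oE (𝒢'.graph.edgeOf β) (hsE _)
    (𝒢.graph.edgeOf (φ.base.branchMap β)) (φ.base.edgeOf_branchMap β).symm
  have hxQ : FE.map (ιd ≫ fe) y ∈ Set.range (FE.map Qa) := by
    rw [hy]
    refine ⟨Fe.map kE tE, ?_⟩
    change Fe.map (Φe.map Qa) (Fe.map kE tE) = _
    rw [← FintypeCat.comp_apply, ← Fe.map_comp]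
    exact congrArg (fun m => Fe.map m tE) hkE
  obtain ⟨md, hmd⟩ := (factor_iff_map_mem_range FE Qa (ιd ≫ fe) y).mpr hxQ
  have E2 : (md ≫ n) ≫ bY.map (oV ω).1.arrow ≫ Aψh = ιd ≫ fe := by
    rw [Category.assoc, hn, hmd]
  -- compare the two descriptions of `f(d)` on the fibre and peel off `ψ_b`
  have p1 : FE.map Aψh (FE.map (bY.map (ιc ≫ fu)) (FE.map k y)) = FE.map (ιd ≫ fe) y := by
    have h := congrArg (fun m => FE.map m y) E1
    simpa only [Functor.map_comp, FintypeCat.comp_apply] using h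
  have p2 : FE.map Aψh (FE.map (bY.map (oV ω).1.arrow) (FE.map (md ≫ n) y)) = FE.map (ιd ≫ fe) y := by
    have h := congrArg (fun m => FE.map m y) E2
    simpa only [Functor.map_comp, FintypeCat.comp_apply] using h
  have hz : FE.map (bY.map (ιc ≫ fu)) (FE.map k y) =
      FE.map (bY.map (oV ω).1.arrow) (FE.map (md ≫ n) y) :=
    map_iso_injective FE Aψ (p1.trans p2.symm)
  exact (factor_iff_map_mem_range FV (oV ω).1.arrow (ιc ≫ fu) (FE.map k y)).mpr
    ⟨FE.map (md ≫ n) y, hz.symm⟩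

/-! ### Vertex ⇒ edge: finding the edge of `K` through the labels -/

/-- **Vertex ⇒ edge step of the sheet walk.**  Let `w ∈ K` with `c ⊆ Y_u` (`u = φ w`) a component
LABELLED by `oV w` (`f|_c` factors through `oV w ↪ A_u`) whose section fibre `Ψ_c` factors through
`W_w`; let `b₁` be a branch of `ℍ` abutting to `u` and `d ⊆ Y_{e}` (`e` the edge of `b₁`) a component
under `c` along `b₁`.  Then there is an edge `e′ ∈ K` over `e` — the `oE`-preimage of the component of
`A_e` holding `f(d)`; its branch over `b₁` abuts to `w` by the branch clause and the injectivity of the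
vertex labels — such that `W_{e′}` MEETS the edge section fibre `Ψ_d` (for some basepoint).
[cite: MochizukiSemiAnbd2006, Cor. 2.7(i) p.30] -/
theorem Hom.walkStep_vertex_to_edge (φ : Hom 𝒢' 𝒢) (A : 𝒢.BObj) (H : 𝒢.graph.Subgraph)
    (K : 𝒢'.graph.Subgraph) (hKV : K.verts ⊆ φ.base.vertexMap ⁻¹' H.verts)
    (hKE : K.edges ⊆ φ.base.edgeMap ⁻¹' H.edges) (hK : φ.IsPreimageComponent H K)
    (hprop : SemiGraph.IsProper φ.base) (hHg : H.toSemiGraph.IsGraph)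
    (T : 𝒢'.BObj) (hTV : ∀ v', IsTerminal (T.S v')) (hTE : ∀ e', IsTerminal (T.T e'))
    (s : T ⟶ φ.pullbackFunctor.obj A)
    (oV : ∀ v' : 𝒢'.graph.Vertex, π₀Obj (A.S (φ.base.vertexMap v')))
    (oE : ∀ e' : 𝒢'.graph.Edge, π₀Obj (A.T (φ.base.edgeMap e')))
    (hoV : Function.Injective (fun v' : 𝒢'.graph.Vertex =>
      (⟨φ.base.vertexMap v', oV v'⟩ : Σ v, π₀Obj (A.S v))))
    (hoE : Function.Surjective (fun e' : 𝒢'.graph.Edge =>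
      (⟨φ.base.edgeMap e', oE e'⟩ : Σ e, π₀Obj (A.T e))))
    (hobr : ∀ (b' : 𝒢'.graph.Branch) (v' : 𝒢'.graph.Vertex) (h' : 𝒢'.graph.abuts b' = some v'),
      ∃ f : ((oE (𝒢'.graph.edgeOf b')).1 : 𝒢.E (φ.base.edgeMap (𝒢'.graph.edgeOf b'))) ⟶
          (𝒢.transportE (φ.base.edgeOf_branchMap b')).obj
            ((𝒢.pull (φ.base.branchMap b') (φ.base.vertexMap v')
              (φ.base.abuts_branchMap b' v' h')).pullback.obj ((oV v').1 : 𝒢.V (φ.base.vertexMap v'))),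
        f ≫ (𝒢.transportE (φ.base.edgeOf_branchMap b')).map
              ((𝒢.pull _ _ (φ.base.abuts_branchMap b' v' h')).pullback.map (oV v').1.arrow ≫
                (A.ψ (φ.base.branchMap b') (φ.base.vertexMap v') (φ.base.abuts_branchMap b' v' h')).hom) ≫
            eqToHom (𝒢.transportE_obj_T A (φ.base.edgeOf_branchMap b')) =
          (oE (𝒢'.graph.edgeOf b')).1.arrow)
    (hsE : ∀ e', ∃ k : T.T e' ⟶ (φ.φE e' (φ.base.edgeMap e') rfl).pullback.obj (oE e').1,
      k ≫ (φ.φE e' (φ.base.edgeMap e') rfl).pullback.map (oE e').1.arrow = s.fT e')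
    (Y : (𝒢.restrict H).BObj) (f : Y ⟶ (𝒢.restrictFunctor H).obj A)
    {W : (𝒢'.restrict K).BObj} (j : W ⟶ (φ.restrict K H hKV hKE).pullbackFunctor.obj Y) [Mono j]
    (w : 𝒢'.graph.Vertex) (hw : w ∈ K.verts) (b₁ : 𝒢.graph.Branch)
    (hb₁H : 𝒢.graph.edgeOf b₁ ∈ H.edges) (hb₁w : 𝒢.graph.abuts b₁ = some (φ.base.vertexMap w))
    (c : π₀Obj (Y.S ⟨φ.base.vertexMap w, hKV hw⟩)) (d : π₀Obj (Y.T ⟨𝒢.graph.edgeOf b₁, hb₁H⟩))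
    (hdc : d.1 ≤ Y.branchImage ⟨b₁, hb₁H⟩ ⟨φ.base.vertexMap w, hKV hw⟩
      ((SemiGraph.Subgraph.abuts_eq_some_iff H _ _).mpr hb₁w) c.1)
    (hlab : ∃ m : (Subobject.underlying.obj c.1 : 𝒢.V (φ.base.vertexMap w)) ⟶
        Subobject.underlying.obj (oV w).1,
      m ≫ (oV w).1.arrow = c.1.arrow ≫ f.fS ⟨φ.base.vertexMap w, hKV hw⟩)
    (hfac : ∃ g : pullback ((φ.φV w).pullback.map (c.1.arrow ≫ f.fS ⟨φ.base.vertexMap w, hKV hw⟩))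
        (s.fS w) ⟶ W.S ⟨w, hw⟩,
      g ≫ j.fS ⟨w, hw⟩ = pullback.fst ((φ.φV w).pullback.map
        (c.1.arrow ≫ f.fS ⟨φ.base.vertexMap w, hKV hw⟩)) (s.fS w) ≫ (φ.φV w).pullback.map c.1.arrow) :
    ∃ (e' : 𝒢'.graph.Edge) (he' : e' ∈ K.edges) (p : φ.base.edgeMap e' = 𝒢.graph.edgeOf b₁)
      (Fe : 𝒢'.E e' ⥤ FintypeCat.{v₁}) (_ : FiberFunctor Fe)
      (π : Fe.obj (pullback ((φ.φE e' (𝒢.graph.edgeOf b₁) p).pullback.map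
          (d.1.arrow ≫ f.fT ⟨𝒢.graph.edgeOf b₁, hb₁H⟩))
        (s.fT e' ≫ (φ.reindexIso e' (φ.base.edgeMap e') (𝒢.graph.edgeOf b₁) rfl p).hom.app A)))
      (ϖ : Fe.obj (W.T ⟨e', he'⟩)),
      Fe.map (j.fT ⟨e', he'⟩ ≫ ((φ.restrict K H hKV hKE).reindexIso ⟨e', he'⟩
          ⟨𝒢.graph.edgeOf b₁, hb₁H⟩ ⟨φ.base.edgeMap e', hKE he'⟩ (Subtype.ext p) rfl).inv.app Y) ϖ =
        Fe.map (pullback.fst _ _ ≫ (φ.φE e' (𝒢.graph.edgeOf b₁) p).pullback.map d.1.arrow) π := by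
  obtain ⟨mc, hmc⟩ := hlab
  obtain ⟨g, hg⟩ := hfac
  have hbu : H.toSemiGraph.abuts ⟨b₁, hb₁H⟩ = some (⟨φ.base.vertexMap w, hKV hw⟩ : H.toSemiGraph.Vertex) :=
    (SemiGraph.Subgraph.abuts_eq_some_iff H _ _).mpr hb₁w
  -- canonical names at the vertex
  let cY : 𝒢.V (φ.base.vertexMap w) := Subobject.underlying.obj c.1
  let dY : 𝒢.E (𝒢.graph.edgeOf b₁) := Subobject.underlying.obj d.1
  haveI : PreGaloisCategory.IsConnected cY := c.2
  haveI : PreGaloisCategory.IsConnected dY := d.2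
  let ιc : cY ⟶ Y.S ⟨φ.base.vertexMap w, hKV hw⟩ := c.1.arrow
  let ιd : dY ⟶ Y.T ⟨𝒢.graph.edgeOf b₁, hb₁H⟩ := d.1.arrow
  let bY : 𝒢.V (φ.base.vertexMap w) ⥤ 𝒢.E (𝒢.graph.edgeOf b₁) :=
    (𝒢.pull b₁ (φ.base.vertexMap w) hb₁w).pullback
  haveI : PreservesFiniteLimits bY := (𝒢.pull _ _ _).property.1
  haveI : PreservesFiniteColimits bY := (𝒢.pull _ _ _).property.2
  let Aψ := A.ψ b₁ (φ.base.vertexMap w) hb₁w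
  let Aψh : bY.obj (A.S (φ.base.vertexMap w)) ⟶ A.T (𝒢.graph.edgeOf b₁) := Aψ.hom
  let Yψh : bY.obj (Y.S ⟨φ.base.vertexMap w, hKV hw⟩) ⟶ Y.T ⟨𝒢.graph.edgeOf b₁, hb₁H⟩ :=
    (Y.ψ ⟨b₁, hb₁H⟩ ⟨φ.base.vertexMap w, hKV hw⟩ hbu).hom
  let fu : Y.S ⟨φ.base.vertexMap w, hKV hw⟩ ⟶ A.S (φ.base.vertexMap w) :=
    f.fS ⟨φ.base.vertexMap w, hKV hw⟩
  let fe : Y.T ⟨𝒢.graph.edgeOf b₁, hb₁H⟩ ⟶ A.T (𝒢.graph.edgeOf b₁) := f.fT ⟨𝒢.graph.edgeOf b₁, hb₁H⟩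
  let oa : Subobject.underlying.obj (oV w).1 ⟶ A.S (φ.base.vertexMap w) := (oV w).1.arrow
  -- `d` under `c`
  haveI hmono : Mono (((𝒢.restrict H).pull ⟨b₁, hb₁H⟩ ⟨φ.base.vertexMap w, hKV hw⟩
      hbu).pullback.map c.1.arrow ≫ (Y.ψ ⟨b₁, hb₁H⟩ ⟨φ.base.vertexMap w, hKV hw⟩ hbu).hom) :=
    Y.mono_map_arrow_comp_ψ _ _ hbu c.1
  let k : dY ⟶ bY.obj cY := @Subobject.ofLEMk _ _ _ _ d.1 _ hmono hdc
  have hk : k ≫ bY.map ιc ≫ Yψh = ιd := @Subobject.ofLEMk_comp _ _ _ _ d.1 _ hmono hdc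
  have hf : bY.map fu ≫ Aψh = Yψh ≫ fe := f.comm ⟨b₁, hb₁H⟩ ⟨φ.base.vertexMap w, hKV hw⟩ hbu
  have E1 : (k ≫ bY.map mc) ≫ bY.map oa ≫ Aψh = ιd ≫ fe := by
    calc (k ≫ bY.map mc) ≫ bY.map oa ≫ Aψh = k ≫ (bY.map mc ≫ bY.map oa) ≫ Aψh := by
          simp only [Category.assoc]
      _ = k ≫ bY.map (ιc ≫ fu) ≫ Aψh := by rw [← bY.map_comp, hmc]; rfl
      _ = k ≫ bY.map ιc ≫ (bY.map fu ≫ Aψh) := by rw [bY.map_comp, Category.assoc]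
      _ = k ≫ bY.map ιc ≫ Yψh ≫ fe := by rw [hf]
      _ = (k ≫ bY.map ιc ≫ Yψh) ≫ fe := by simp only [Category.assoc]
      _ = ιd ≫ fe := by rw [hk]
  -- the component `Q'` of `A_e` holding `f(d)`
  let FA := GaloisCategory.getFiberFunctor (𝒢.E (𝒢.graph.edgeOf b₁))
  obtain ⟨y₀⟩ := nonempty_fiber_of_isConnected FA dY
  obtain ⟨Q', hQ'⟩ := exists_component_mem_range FA (FA.map (ιd ≫ fe) y₀)
  haveI : PreGaloisCategory.IsConnected (Subobject.underlying.obj Q'.1) := Q'.2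
  obtain ⟨md, hmd⟩ := (factor_iff_map_mem_range FA Q'.1.arrow (ιd ≫ fe) y₀).mpr hQ'
  -- `Q'` lies under `oV w` along `b₁`
  have hcompw : A.componentOver b₁ (φ.base.vertexMap w) hb₁w Q' = oV w := by
    refine A.componentOver_eq_of_mem_ranges b₁ _ hb₁w Q' (oV w) FA (FA.map (ιd ≫ fe) y₀) hQ' ?_
    refine ⟨FA.map (k ≫ bY.map mc) y₀, ?_⟩
    have h := congrArg (fun m => FA.map m y₀) E1
    simpa only [Functor.map_comp, FintypeCat.comp_apply] using h
  -- the edge of `𝒢′` labelled `(e, Q')` and a branch of it over `b₁`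
  obtain ⟨f', hf'⟩ := hoE ⟨𝒢.graph.edgeOf b₁, Q'⟩
  have pf : φ.base.edgeMap f' = 𝒢.graph.edgeOf b₁ := congrArg Sigma.fst hf'
  have hQ : HEq (oE f') Q' := (Sigma.mk.inj_iff.mp hf').2
  obtain ⟨β, w₃, hβf, hβb, hβω, hw₃⟩ :=
    SemiGraph.exists_branch_preimage_abuts φ.base hprop f' b₁ pf.symm (φ.base.vertexMap w) hb₁w
  subst hβf
  -- the branch `β` abuts to `w`: compare labels
  have hQt : ((pf ▸ oE (𝒢'.graph.edgeOf β) : π₀Obj (A.T (𝒢.graph.edgeOf b₁)))) = Q' :=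
    φ.eqRec_localLabel_eq_of_heq A oE pf hQ
  have hcomp3 : A.componentOver b₁ (φ.base.vertexMap w₃) (hβb ▸ φ.base.abuts_branchMap β w₃ hβω)
      (pf ▸ oE (𝒢'.graph.edgeOf β)) = oV w₃ :=
    φ.componentOver_localLabel_eq A oV oE hobr β w₃ hβω b₁ hβb
  have e1 : (⟨φ.base.vertexMap w₃, oV w₃⟩ : Σ v, π₀Obj (A.S v)) =
      ⟨φ.base.vertexMap w₃, A.componentOver b₁ (φ.base.vertexMap w₃)
        (hβb ▸ φ.base.abuts_branchMap β w₃ hβω) Q'⟩ := by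
    rw [← hQt, hcomp3]
  have e2 := A.sigma_componentOver_eq b₁ (φ.base.vertexMap w₃) (φ.base.vertexMap w)
    (hβb ▸ φ.base.abuts_branchMap β w₃ hβω) hb₁w Q'
  have e3 : (⟨φ.base.vertexMap w, A.componentOver b₁ (φ.base.vertexMap w) hb₁w Q'⟩ :
      Σ v, π₀Obj (A.S v)) = ⟨φ.base.vertexMap w, oV w⟩ := by rw [hcompw]
  have hw₃ : w₃ = w := hoV (e1.trans (e2.trans e3))
  subst w₃
  subst hβb
  -- hence the edge of `β` lies in `K`
  have hfK : 𝒢'.graph.edgeOf β ∈ K.edges :=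
    hK.mem_edges_of_abuts hprop hHg hw hβω (by rw [pf]; exact hb₁H)
  -- the edge section fibre at `f′ = edgeOf β` has a point
  let Fe := GaloisCategory.getFiberFunctor (𝒢'.E (𝒢'.graph.edgeOf β))
  let Φe : 𝒢.E (𝒢.graph.edgeOf (φ.base.branchMap β)) ⥤ 𝒢'.E (𝒢'.graph.edgeOf β) :=
    (φ.φE (𝒢'.graph.edgeOf β) (𝒢.graph.edgeOf (φ.base.branchMap β)) pf).pullback
  haveI : PreservesFiniteLimits Φe := (φ.φE _ _ _).property.1
  haveI : PreservesFiniteColimits Φe := (φ.φE _ _ _).property.2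
  let FE : 𝒢.E (𝒢.graph.edgeOf (φ.base.branchMap β)) ⥤ FintypeCat.{v₁} := Φe ⋙ Fe
  haveI : FiberFunctor FE := fiberFunctor_comp_of_exact _ _
  let sE : T.T (𝒢'.graph.edgeOf β) ⟶ Φe.obj (A.T (𝒢.graph.edgeOf (φ.base.branchMap β))) :=
    s.fT (𝒢'.graph.edgeOf β) ≫
      (φ.reindexIso (𝒢'.graph.edgeOf β) (φ.base.edgeMap (𝒢'.graph.edgeOf β))
        (𝒢.graph.edgeOf (φ.base.branchMap β)) rfl pf).hom.app A
  haveI : Subsingleton (Fe.obj (T.T (𝒢'.graph.edgeOf β))) :=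
    subsingleton_fiber_of_isTerminal Fe (hTE _)
  obtain ⟨tE⟩ := nonempty_fiber_of_isTerminal Fe (hTE (𝒢'.graph.edgeOf β))
  obtain ⟨kE, hkE⟩ := φ.sectionE_factors_reindexed A s oE (𝒢'.graph.edgeOf β) (hsE _)
    (𝒢.graph.edgeOf (φ.base.branchMap β)) pf
  have hx : Fe.map sE tE ∈ Set.range (FE.map Q'.1.arrow) := by
    rw [← hQt]
    refine ⟨Fe.map kE tE, ?_⟩
    change Fe.map (Φe.map _) (Fe.map kE tE) = _
    rw [← FintypeCat.comp_apply, ← Fe.map_comp]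
    exact congrArg (fun m => Fe.map m tE) hkE
  obtain ⟨q, hq⟩ := hx
  obtain ⟨y₁⟩ := nonempty_fiber_of_isConnected FE dY
  obtain ⟨y, hyq⟩ := surjective_of_nonempty_fiber_of_isConnected FE md q
  have hy : Fe.map (Φe.map (ιd ≫ fe)) y = Fe.map sE tE := by
    rw [← hmd, ← hq, ← hyq]
    change Fe.map (Φe.map (md ≫ Q'.1.arrow)) y = Fe.map (Φe.map _) (Fe.map (Φe.map md) y)
    rw [Φe.map_comp, Fe.map_comp, FintypeCat.comp_apply]
  let π : Fe.obj (pullback (Φe.map (ιd ≫ fe)) sE) :=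
    (fiberPullbackEquiv Fe (Φe.map (ιd ≫ fe)) sE).symm ⟨(y, tE), hy⟩
  -- part C: vertex ⇒ edge
  obtain ⟨ϖ, hϖ⟩ := φ.sectionFibre_edge_meets_of_vertex_factors A H K hKV hKE T hTV hTE s β w hβω hw
    hfK hb₁H Y f j ιc ιd k hk g hg Fe π
  exact ⟨𝒢'.graph.edgeOf β, hfK, pf, Fe, inferInstance, π, ϖ, hϖ⟩

end SemiGraphOfAnabelioids

end Literature.AnabelianGeometry.SemiGraphs
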